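import Mathlib
import HarnessLib
import Literature.RingTheory.CohomologyAnnihilator.Basic
import Literature.RingTheory.CohomologyAnnihilator.StrongGenerator
import Summits.ResolutionOfSingularities.ResolutionOfSingularities.Theorems.HomologicalConductorNoZenoCaPrincipalSky

/-!
# Crux `NoZenoR` / `NoZeno` (stmt-ResolutionOfSingularities-19943 / -16483), line `sandwich-cluster`,
# S3 — the assembly of THEOREM Q-rat over an abstract exceptional datum (helper for the v15 stub
# `stub_caInvertibleMinRes` = G4′ and the derived `stub_skyPrincipal`)

Route `ResolutionOfSingularities/HomologicalConductor`.  OURS (cell res-hironaka, crux chain W4.4, seat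
res-D-pv-026 as res-L0-w44-stub-9); nothing here is a statement of the manuscript under review
(Hironaka 2017); AI-written, weaker than expert review.  Skeleton of record v15 (res-L0-w44-lead-1,
2026-08-27T05:10Z): `NoZenoR_of : CJS → GE → G4′ → P1.3′ → Exh → Nex → CompHigh → NoZenoR`, with
`stub_skyPrincipal` derived from G4′ over the bridge `…NoZenoSkyBridge`; this file is a HELPER for the
lead's proof of G4′ from CA4 + G1 + G2 + G3 (KERNEL-L0 §16 R6), no stub credit.

THEOREM Q-rat (res-L0-w44-idea-1 `S3-structural-proof.md` §5, refereed twice on paper) proves the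
registered v14 stub `stub_skyPrincipal` — «for a singular sandwiched stage `T = T_m` and a sky point
`S ⊇ T`, the ideal of `S` generated by `ca(T)` is principal» — from five inputs: the CA-layer (CA4:
`caⁿ(T) = ⋂ s̲ann(L*)` over the `(n-1)`-st syzygies `L`), Lemma C + Lemma A of the G-layer (each
`s̲ann(L*)` is a VALUATION IDEAL `I_{Z(L)} = {a ∈ T : ord_{E_i}(a) ≥ Z(L)_i}` of the exceptional prime
divisors `E_i` of the minimal resolution `X = X_min(T)`), Lipman 1969 (12.1)(ii) (for an anti-nef cycle
`Z` on the resolution of a RATIONAL `T`, `I_Z · 𝒪_X = 𝒪_X(-Z)` is invertible, so `I_Z · 𝒪_{X,x}` is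
principal at every closed point `x`), and the lifting lemma P1.3 (a sky point dominates some `𝒪_{X,x}`).

This file is the ASSEMBLY of these inputs, kernel-checked over an ABSTRACT EXCEPTIONAL DATUM so that it
does not depend on the vocabulary in which the G-layer will be written (scheme side `IsMinimalResolution`
/ `Scheme.ord`, or bespoke sky rings inside `K`): an index type `ι` (↔ the `E_i`), maps
`v : ι → K → ℕ∞` (↔ `ord_{E_i}`, evaluated on `T` only), for a cycle `Z : ι → ℕ` the valuation set
`{a ∈ T | ∀ i, Z i ≤ v i a}` (↔ `I_Z = H⁰(X, 𝒪_X(-Z)) ∩ T`), a `k`-subalgebra `P` with `T ≤ P ≤ S`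
(↔ the `𝒪_{X,x}` of P1.3), and — for the Laufer–Lipman form — an integer pairing `B : ι → ι → ℤ` with
non-negative off-diagonal entries (↔ the intersection matrix `(E_j · E_i)`).

* `exists_cycle_forall_le_iff` — a coordinatewise-bounded family of cycles has a supremum cycle:
  `⋂_j I_{Z_j} = I_{sup_j Z_j}`.
* `isPrincipal_span_ca_of_cycle`, `isPrincipal_span_ca_of_cycleFamily` — if `ca(T) = I_Z` (resp.
  `= ⋂_j I_{Z_j}` with some `y ∈ ca(T)` of finite values) and `I_Z · P` is principal for every cycle,
  then `ca(T) · S` is principal for every `S ≥ P` (ascent, `isPrincipal_span_ca_of_le`, p489646).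
* `exists_cycle_of_cycleFamily` — with some `y ∈ ca(T)` of finite values, a family description
  `ca(T) = ⋂_j I_{Z_j}` collapses to one cycle, `ca(T) = I_{sup_j Z_j}` (Q-rat (E5)).
* `ca_iff_forall_cycle_of_forall_iff` (+ `cohomologyAnnihilator_eq_of_stable_le`) — (E1)–(E4) of
  Q-rat §5 in abstract form: from `ca(T) = caⁿ(T)` (strong generation, `n ≥ s`), a CA4-shaped
  description `x ∈ caⁿ(T) ↔ ∀ q, Stab x q` by a family of tests (CRUX-PLAN v6 §A CA4: `q = (M, L)`,
  `M` finitely generated, `L` an `(n-1)`-st syzygy of `M`, `Stab x q` = «`x • 𝟙_{L*}` factors through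
  a finitely generated projective», `n ≥ max s 4`) and a Lemma-C-shaped one `∀ q, ∃ Z(q),
  {x | Stab x q} = I_{Z(q)}` (rows G1/G2), the family form `ca(T) = ⋂_q I_{Z(q)}` inside `K`.  The
  test predicate is a parameter, so the theorem does not depend on how A0 `StablyAnnihilates` lands.
* `exists_antinef_cycle_of_forall_sum_le` — Laufer's hull in gcd form: if every nonzero `a ∈ T` has
  an ANTI-NEF cycle of values (`Σ_j v_j(a) B j i ≤ 0` for all `i`: a principal divisor has degree `0`
  on each complete curve `E_i` and its strict transform meets `E_i` non-negatively), then every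
  valuation set containing a nonzero element equals `I_{Z'}` for an anti-nef `Z' ≥ Z` (the gcd cycle).
* `skyPrincipal_of_cycleFamily`, `skyPrincipal_of_cycleFamily_of_antinef` — **the G4 assembly at a
  singular stage `T_m`, `m ≥ m₀ + 1`, of the sandwich context**: the conclusion of `stub_skyPrincipal`
  from the inputs above, the nonzero `y ∈ ca(T_m)` being supplied by the tree
  (`exists_admissible_of_not_isRegularLocalRing`); the second form takes Lipman (12.1)(ii) at
  ANTI-NEF cycles only.

* `isPrincipal_map_cohomologyAnnihilator_of_cycle`, `caMapPrincipal_of_cycleFamily`,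
  `caMapPrincipal_of_cycleFamily_of_antinef` — the same assembly concluding at a ring map
  `φ : ↥T_m →+* P` (`(Ideal.map φ (ca ↥T_m)).IsPrincipal`): the shape of the v15 registered stub
  `stub_caInvertibleMinRes` (G4′, `φ = toStalk π x`), for the lead's assembly over the bridge.

What is NOT here: the inputs themselves (CA4 — stub-7; Lemma A sheaf half / Lemma C / (B4) — rows
G1/G2; Lipman 1969 named facts — stub-4; P1.3 — stub-6) and the final instantiation of
`stub_skyPrincipal` with its registered signature, which imports their files (second file of this row).
No `def` is introduced (CHAIN v6 §4 rule 15): valuation sets and the stable-annihilation predicate are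
written out in each statement.

References: res-L0-w44-idea-1, THEOREM Q-rat (OURS, 2026-08-27); res-L0-w44-plan-1 CRUX-PLAN v6 §A–§B;
J. Lipman, Publ. Math. IHÉS 36 (1969), Thm. (12.1) [`Lipman1969`]; H. Laufer, Amer. J. Math. 94 (1972)
(anti-nef hull) — used only as folklore lattice bookkeeping here.
-/

noncomputable section

-- single-problem summit: the doubled namespace component `ResolutionOfSingularities` is forced
set_option linter.dupNamespace false

namespace Summit.ResolutionOfSingularities.ResolutionOfSingularities.Theorems.NoZeno.SandwichCluster

open IsLocalRing Literature.AlgebraicGeometry.Resolution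
open Summit.ResolutionOfSingularities.ResolutionOfSingularities.Theorems
open Summit.ResolutionOfSingularities.ResolutionOfSingularities.Theorems.NoZeno.Birth
open Summit.ResolutionOfSingularities.ResolutionOfSingularities.Theses.HomologicalConductor
open CategoryTheory
open Literature.RingTheory.CohomologyAnnihilator (cohomologyAnnihilator cohomologyAnnihilatorOfDegree
  IsSyzygy mem_cohomologyAnnihilator_iff' cohomologyAnnihilatorOfDegree_le
  cohomologyAnnihilatorOfDegree_mono exists_cohomologyAnnihilator_eq_of_isNoetherianRing)

variable {k K : Type} [Field k] [Field K] [Algebra k K]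

/-! ## §0 Cycles: the supremum of a bounded family -/

/-- A family of cycles `Z_j : ι → ℕ` bounded coordinatewise has a SUPREMUM CYCLE `Zs` (coordinatewise
`sSup`; the zero cycle for an empty family): for every `w : ι → ℕ∞`, `(∀ j i, Z_j i ≤ w i) ↔ (∀ i, Zs i ≤ w i)`.
In valuation-ideal terms: `⋂_j I_{Z_j} = I_{Zs}`. [folklore] -/
theorem exists_cycle_forall_le_iff {ι : Type*} {J : Sort*} (Z : J → ι → ℕ) (b : ι → ℕ)
    (hb : ∀ j i, Z j i ≤ b i) :
    ∃ Zs : ι → ℕ, (∀ j i, Z j i ≤ Zs i) ∧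
      ∀ w : ι → ℕ∞, (∀ j i, (Z j i : ℕ∞) ≤ w i) ↔ ∀ i, (Zs i : ℕ∞) ≤ w i := by
  -- the supremum in `ℕ∞`, finite because bounded by `b`
  have hfin : ∀ i, (⨆ j, (Z j i : ℕ∞)) ≠ ⊤ := fun i =>
    ne_top_of_le_ne_top (ENat.coe_ne_top (b i)) (iSup_le fun j => Nat.cast_le.mpr (hb j i))
  have hcoe : ∀ i, (((⨆ j, (Z j i : ℕ∞)).toNat : ℕ) : ℕ∞) = ⨆ j, (Z j i : ℕ∞) := fun i =>
    ENat.coe_toNat (hfin i)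
  refine ⟨fun i => (⨆ j, (Z j i : ℕ∞)).toNat, fun j i => ?_, fun w => ⟨fun h i => ?_, fun h j i => ?_⟩⟩
  · have h := le_iSup (fun j => (Z j i : ℕ∞)) j
    rw [← hcoe i, Nat.cast_le] at h
    exact h
  · rw [hcoe i]
    exact iSup_le fun j => h j i
  · exact (le_iSup (fun j => (Z j i : ℕ∞)) j).trans ((hcoe i).ge.trans (h i))

/-! ## §1 Ascent from one valuation ideal -/

/-- **G4, one cycle.**  If `ca(T)` is the valuation set `I_Z = {a ∈ T | ∀ i, Z i ≤ v i a}` of a single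
cycle and `I_Z · P` is principal for some `T ≤ P ≤ S`, then `ca(T) · S` is principal. [folklore] -/
theorem isPrincipal_span_ca_of_cycle {T P S : Subalgebra k K} (hTP : T ≤ P) (hPS : P ≤ S)
    {ι : Type*} (v : ι → K → ℕ∞) (Z : ι → ℕ)
    (hca : ∀ a : K, a ∈ ca T ↔ a ∈ T ∧ ∀ i, (Z i : ℕ∞) ≤ v i a)
    (hLip : (Ideal.span {s : ↥P | (s : K) ∈ T ∧ ∀ i, (Z i : ℕ∞) ≤ v i (s : K)}).IsPrincipal) :
    (Ideal.span {s : ↥S | (s : K) ∈ ca T}).IsPrincipal := by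
  have hset : {s : ↥P | (s : K) ∈ ca T} =
      {s : ↥P | (s : K) ∈ T ∧ ∀ i, (Z i : ℕ∞) ≤ v i (s : K)} :=
    Set.ext fun s => hca s
  exact isPrincipal_span_ca_of_le hTP hPS (by rw [hset]; exact hLip)

/-- A family form `ca(T) = ⋂_j I_{Z_j}` with some `y ∈ ca(T)` of finite values collapses to a
single cycle: the family is bounded by the values of `y`, so `ca(T) = I_{sup_j Z_j}` (Q-rat (E5): the
cycles `Z(L)` below `Z_y` are finitely many / bounded). [folklore] -/
theorem exists_cycle_of_cycleFamily (T : Subalgebra k K) {ι : Type*} (v : ι → K → ℕ∞) {J : Sort*}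
    (Z : J → ι → ℕ) (hca : ∀ a : K, a ∈ ca T ↔ a ∈ T ∧ ∀ j i, (Z j i : ℕ∞) ≤ v i a)
    (hy : ∃ y ∈ ca T, ∀ i, v i y ≠ ⊤) :
    ∃ Zs : ι → ℕ, (∀ j i, Z j i ≤ Zs i) ∧ ∀ a : K, a ∈ ca T ↔ a ∈ T ∧ ∀ i, (Zs i : ℕ∞) ≤ v i a := by
  obtain ⟨y, hyca, hyfin⟩ := hy
  have hyZ := ((hca y).mp hyca).2
  obtain ⟨Zs, hle, hZs⟩ := exists_cycle_forall_le_iff Z (fun i => (v i y).toNat) fun j i => by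
    have h := hyZ j i
    rw [← ENat.coe_toNat (hyfin i), Nat.cast_le] at h
    exact h
  exact ⟨Zs, hle, fun a => by rw [hca a, hZs]⟩

/-- **G4, a family of cycles.**  If `ca(T) = ⋂_j I_{Z_j}` for a family of cycles (the `Z(L)` of the
syzygies `L`, Q-rat (E4)), some `y ∈ ca(T)` has finite values (any nonzero element of the `𝔪`-primary
`ca(T)`), and `I_Z · P` is principal for EVERY cycle `Z` (`T ≤ P ≤ S`; Laufer + Lipman (12.1)(ii) at the
local ring `P = 𝒪_{X,x}` of a rational `T`), then `ca(T) · S` is principal (`ca(T) = I_{sup_j Z_j}`,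
Q-rat (E5)). [folklore] -/
theorem isPrincipal_span_ca_of_cycleFamily {T P S : Subalgebra k K} (hTP : T ≤ P) (hPS : P ≤ S)
    {ι : Type*} (v : ι → K → ℕ∞) {J : Sort*} (Z : J → ι → ℕ)
    (hca : ∀ a : K, a ∈ ca T ↔ a ∈ T ∧ ∀ j i, (Z j i : ℕ∞) ≤ v i a)
    (hy : ∃ y ∈ ca T, ∀ i, v i y ≠ ⊤)
    (hLip : ∀ Z : ι → ℕ,
      (Ideal.span {s : ↥P | (s : K) ∈ T ∧ ∀ i, (Z i : ℕ∞) ≤ v i (s : K)}).IsPrincipal) :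
    (Ideal.span {s : ↥S | (s : K) ∈ ca T}).IsPrincipal := by
  obtain ⟨Zs, -, hZs⟩ := exists_cycle_of_cycleFamily T v Z hca hy
  exact isPrincipal_span_ca_of_cycle hTP hPS v Zs hZs (hLip Zs)

/-! ## §2 From the CA-layer and Lemma C to the family of cycles (Q-rat (E1)–(E4)) -/

/-- **(E1)–(E4), abstract form.**  Let `ca(↥T) = caⁿ(↥T)` (strong generation: `ca = caˢ` for some `s`,
take `n ≥ s`), let `caⁿ(↥T)` be cut out by a family of tests `Stab x q` (`q : Q`; CA4: «`x` stably
annihilates `L*`» over the `(n-1)`-st syzygies `L`), and let each test set `{x | Stab x q}` be a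
valuation set `I_{Z(q)}` (Lemma C + Lemma A).  Then `ca(T) = ⋂_q I_{Z(q)}` inside `K`. [folklore] -/
theorem ca_iff_forall_cycle_of_forall_iff (T : Subalgebra k K) {ι : Type*} (v : ι → K → ℕ∞) (n : ℕ)
    (hn : cohomologyAnnihilator ↥T = cohomologyAnnihilatorOfDegree ↥T n)
    {Q : Sort*} (Stab : ↥T → Q → Prop)
    (hCA : ∀ x : ↥T, x ∈ cohomologyAnnihilatorOfDegree ↥T n ↔ ∀ q, Stab x q)
    (hLC : ∀ q, ∃ Z : ι → ℕ, ∀ x : ↥T, Stab x q ↔ ∀ i, (Z i : ℕ∞) ≤ v i (x : K)) :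
    ∃ Z : Q → ι → ℕ, ∀ a : K, a ∈ ca T ↔ a ∈ T ∧ ∀ q i, (Z q i : ℕ∞) ≤ v i a := by
  classical
  choose Z hZ using hLC
  refine ⟨Z, fun a => ⟨fun ha => ?_, fun ⟨haT, h⟩ => ?_⟩⟩
  · have haT : a ∈ T := ca_subset T ha
    have hx : (⟨a, haT⟩ : ↥T) ∈ cohomologyAnnihilatorOfDegree ↥T n := by
      rw [← hn]; exact (tn_coe_mem_ca_iff T ⟨a, haT⟩).mp ha
    exact ⟨haT, fun q => (hZ q ⟨a, haT⟩).mp ((hCA ⟨a, haT⟩).mp hx q)⟩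
  · have hx : (⟨a, haT⟩ : ↥T) ∈ cohomologyAnnihilatorOfDegree ↥T n :=
      (hCA ⟨a, haT⟩).mpr fun q => (hZ q ⟨a, haT⟩).mpr (h q)
    have : (⟨a, haT⟩ : ↥T) ∈ cohomologyAnnihilator ↥T := by rw [hn]; exact hx
    exact (tn_coe_mem_ca_iff T ⟨a, haT⟩).mpr this

/-- Strong generation in the form used: `ca(R) = caⁿ(R)` for every `n` beyond the stabilisation index
(tree `exists_cohomologyAnnihilator_eq_of_isNoetherianRing`); G4 takes `n ≥ max s 4`.
[cite: IyengarTakahashi2014, Definition 2.1] -/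
theorem cohomologyAnnihilator_eq_of_stable_le {R : Type*} [CommRing R] {s n : ℕ}
    (hs : cohomologyAnnihilator R = cohomologyAnnihilatorOfDegree R s) (hsn : s ≤ n) :
    cohomologyAnnihilator R = cohomologyAnnihilatorOfDegree R n :=
  le_antisymm (hs.le.trans (cohomologyAnnihilatorOfDegree_mono hsn)) (cohomologyAnnihilatorOfDegree_le n)

/-! ## §3 Laufer's anti-nef hull (gcd form) -/

/-- **The gcd cycle of a valuation set is anti-nef.**  Let `B : ι → ι → ℤ` have non-negative
off-diagonal entries (the intersection matrix `(E_j · E_i)` of the exceptional curves) and suppose every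
nonzero `a ∈ T` has an ANTI-NEF cycle of values, `Σ_j v_j(a) · B j i ≤ 0` for all `i` (on the resolution:
`div(a) · E_i = 0` and the strict transform of `div(a)` meets `E_i` non-negatively).  Then for every cycle
`Z` whose valuation set `I_Z = {a ∈ T | ∀ i, Z i ≤ v i a}` contains a nonzero element, the gcd cycle
`Z' i := min {v_i(a) : a ∈ I_Z, a ≠ 0}` satisfies `Z ≤ Z'`, is anti-nef, and `I_Z = I_{Z'}` — so Lipman's
(12.1)(ii), stated for anti-nef cycles, applies to every valuation set (Laufer's hull argument, in the form
«a componentwise minimum of anti-nef cycles is anti-nef»). [folklore] -/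
theorem exists_antinef_cycle_of_forall_sum_le {ι : Type*} [Fintype ι] (T : Subalgebra k K)
    (v : ι → K → ℕ∞) (hzero : ∀ i, v i 0 = ⊤) (hfin : ∀ i, ∀ a ∈ T, a ≠ 0 → v i a ≠ ⊤)
    (B : ι → ι → ℤ) (hB : ∀ i j, i ≠ j → 0 ≤ B i j)
    (hdiv : ∀ a ∈ T, a ≠ 0 → ∀ i, ∑ j, ((v j a).toNat : ℤ) * B j i ≤ 0)
    (Z : ι → ℕ) (hne : ∃ a ∈ T, a ≠ 0 ∧ ∀ i, (Z i : ℕ∞) ≤ v i a) :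
    ∃ Z' : ι → ℕ, (∀ i, Z i ≤ Z' i) ∧ (∀ i, ∑ j, (Z' j : ℤ) * B j i ≤ 0) ∧
      ∀ a : K, (a ∈ T ∧ ∀ i, (Z i : ℕ∞) ≤ v i a) ↔ (a ∈ T ∧ ∀ i, (Z' i : ℕ∞) ≤ v i a) := by
  classical
  -- the sets of `i`-values of the nonzero elements of `I_Z`, all nonempty
  set V : ι → Set ℕ := fun i =>
    {n | ∃ a ∈ T, a ≠ 0 ∧ (∀ i', (Z i' : ℕ∞) ≤ v i' a) ∧ (v i a).toNat = n} with hV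
  have hVne : ∀ i, (V i).Nonempty := fun i => by
    obtain ⟨a, haT, ha0, haZ⟩ := hne
    exact ⟨(v i a).toNat, a, haT, ha0, haZ, rfl⟩
  -- every nonzero element of `I_Z` bounds the gcd cycle from above
  have hinf_le : ∀ i, ∀ a ∈ T, a ≠ 0 → (∀ i', (Z i' : ℕ∞) ≤ v i' a) → sInf (V i) ≤ (v i a).toNat :=
    fun i a haT ha0 haZ => Nat.sInf_le ⟨a, haT, ha0, haZ, rfl⟩
  refine ⟨fun i => sInf (V i), fun i => ?_, fun i => ?_, fun a => ⟨fun ⟨haT, haZ⟩ => ⟨haT, fun i => ?_⟩,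
    fun ⟨haT, haZ'⟩ => ⟨haT, fun i => ?_⟩⟩⟩
  · -- `Z ≤ Z'`
    obtain ⟨a, haT, ha0, haZ, ha⟩ := Nat.sInf_mem (hVne i)
    have h := haZ i
    rw [← ENat.coe_toNat (hfin i a haT ha0), Nat.cast_le, ha] at h
    exact h
  · -- anti-nef at `i`: compare with the cycle of values of an element realising the minimum at `i`
    obtain ⟨a, haT, ha0, haZ, ha⟩ := Nat.sInf_mem (hVne i)
    refine le_trans (Finset.sum_le_sum fun j _ => ?_) (hdiv a haT ha0 i)
    by_cases hji : j = i
    · subst hji; rw [ha]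
    · exact mul_le_mul_of_nonneg_right (Nat.cast_le.mpr (hinf_le j a haT ha0 haZ)) (hB j i hji)
  · -- `I_Z ⊆ I_{Z'}`
    by_cases ha0 : a = 0
    · rw [ha0, hzero i]; exact le_top
    · rw [← ENat.coe_toNat (hfin i a haT ha0), Nat.cast_le]
      exact hinf_le i a haT ha0 haZ
  · -- `I_{Z'} ⊆ I_Z`
    obtain ⟨a', ha'T, ha'0, ha'Z, ha'⟩ := Nat.sInf_mem (hVne i)
    have h := ha'Z i
    rw [← ENat.coe_toNat (hfin i a' ha'T ha'0), Nat.cast_le, ha'] at h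
    exact (Nat.cast_le.mpr h).trans (haZ' i)

/-! ## §4 The assembly at a singular stage of the sandwich context -/

/-- **G4 assembly (`stub_skyPrincipal` modulo its G-layer inputs), plain form.**  At a SINGULAR stage
`T = T_m`, `m ≥ m₀ + 1`, of the sandwich context: given an exceptional datum `(ι, v)` with finite values on
`T ∖ 0`, a description `ca(T) = ⋂_j I_{Z_j}` by valuation sets (CA4 + Lemma C + Lemma A, packaged by
`ca_iff_forall_cycle_of_forall_iff`), and a `k`-subalgebra `P` with `T ≤ P ≤ S` (P1.3: the local ring of a
closed point of `X_min(T)` dominated by the sky point `S`) at which every valuation set generates a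
principal ideal (Laufer + Lipman (12.1)(ii), `T` rational), the ideal of `S` generated by `ca(T)` is
principal — the conclusion of the registered stub `stub_skyPrincipal`.  The nonzero `y ∈ ca(T)` bounding
the cycles is the tree's admissible denominator (`exists_admissible_of_not_isRegularLocalRing`). [folklore] -/
theorem skyPrincipal_of_cycleFamily (O : ValuationSubring K) (A R : Subalgebra k K) (m₀ : ℕ)
    (ctx : SandwichCtx O A R m₀) (m : ℕ) (hm : m₀ + 1 ≤ m)
    (hsing : ¬ IsRegularLocalRing ↥(tower O A m))
    {ι : Type*} (v : ι → K → ℕ∞) (hfin : ∀ i, ∀ a ∈ tower O A m, a ≠ 0 → v i a ≠ ⊤)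
    {J : Sort*} (Z : J → ι → ℕ)
    (hca : ∀ a : K, a ∈ ca (tower O A m) ↔ a ∈ tower O A m ∧ ∀ j i, (Z j i : ℕ∞) ≤ v i a)
    (P S : Subalgebra k K) (hTP : tower O A m ≤ P) (hPS : P ≤ S)
    (hLip : ∀ Z : ι → ℕ,
      (Ideal.span {s : ↥P | (s : K) ∈ tower O A m ∧ ∀ i, (Z i : ℕ∞) ≤ v i (s : K)}).IsPrincipal) :
    (Ideal.span {s : ↥S | (s : K) ∈ ca (tower O A m)}).IsPrincipal := by
  obtain ⟨hk, hA, hfr, hAO, htr, -⟩ := ctx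
  obtain ⟨n, rfl⟩ : ∃ n, m = n + 1 := ⟨m - 1, by omega⟩
  obtain ⟨y, hyca, hy0, -⟩ := exists_admissible_of_not_isRegularLocalRing O A hk hA hfr hAO htr n hsing
  exact isPrincipal_span_ca_of_cycleFamily hTP hPS v Z hca
    ⟨y, hyca, fun i => hfin i y (ca_subset _ hyca) hy0⟩ hLip

/-- **G4 assembly, Laufer–Lipman form.**  As `skyPrincipal_of_cycleFamily`, with Lipman's (12.1)(ii)
taken at ANTI-NEF cycles only (`Σ_j Z j · B j i ≤ 0` for all `i`, `B` the intersection pairing with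
non-negative off-diagonal entries), the passage to arbitrary valuation sets being
`exists_antinef_cycle_of_forall_sum_le` (every nonzero element of `T` has an anti-nef cycle of values).
[folklore] -/
theorem skyPrincipal_of_cycleFamily_of_antinef (O : ValuationSubring K) (A R : Subalgebra k K)
    (m₀ : ℕ) (ctx : SandwichCtx O A R m₀) (m : ℕ) (hm : m₀ + 1 ≤ m)
    (hsing : ¬ IsRegularLocalRing ↥(tower O A m))
    {ι : Type*} [Fintype ι] (v : ι → K → ℕ∞) (hzero : ∀ i, v i 0 = ⊤)
    (hfin : ∀ i, ∀ a ∈ tower O A m, a ≠ 0 → v i a ≠ ⊤)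
    (B : ι → ι → ℤ) (hB : ∀ i j, i ≠ j → 0 ≤ B i j)
    (hdiv : ∀ a ∈ tower O A m, a ≠ 0 → ∀ i, ∑ j, ((v j a).toNat : ℤ) * B j i ≤ 0)
    {J : Sort*} (Z : J → ι → ℕ)
    (hca : ∀ a : K, a ∈ ca (tower O A m) ↔ a ∈ tower O A m ∧ ∀ j i, (Z j i : ℕ∞) ≤ v i a)
    (P S : Subalgebra k K) (hTP : tower O A m ≤ P) (hPS : P ≤ S)
    (hLip : ∀ Z : ι → ℕ, (∀ i, ∑ j, (Z j : ℤ) * B j i ≤ 0) →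
      (Ideal.span {s : ↥P | (s : K) ∈ tower O A m ∧ ∀ i, (Z i : ℕ∞) ≤ v i (s : K)}).IsPrincipal) :
    (Ideal.span {s : ↥S | (s : K) ∈ ca (tower O A m)}).IsPrincipal := by
  obtain ⟨hk, hA, hfr, hAO, htr, -⟩ := ctx
  obtain ⟨n, rfl⟩ : ∃ n, m = n + 1 := ⟨m - 1, by omega⟩
  obtain ⟨y, hyca, hy0, -⟩ := exists_admissible_of_not_isRegularLocalRing O A hk hA hfr hAO htr n hsing
  have hyT : y ∈ tower O A (n + 1) := ca_subset _ hyca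
  obtain ⟨Zs, -, hZs⟩ := exists_cycle_of_cycleFamily (tower O A (n + 1)) v Z hca
    ⟨y, hyca, fun i => hfin i y hyT hy0⟩
  obtain ⟨Z', -, hanti, hZ'⟩ := exists_antinef_cycle_of_forall_sum_le (tower O A (n + 1)) v hzero hfin
    B hB hdiv Zs ⟨y, hyT, hy0, ((hZs y).mp hyca).2⟩
  exact isPrincipal_span_ca_of_cycle hTP hPS v Z' (fun a => (hZs a).trans (hZ' a)) (hLip Z' hanti)

/-! ## §5 Stalk-level form (for the v15 stub `stub_caInvertibleMinRes` = G4′)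

The registered G4′ concludes `(Ideal.map (toStalk π x) (cohomologyAnnihilator ↥T_m)).IsPrincipal` at the
local rings of the closed fibre of a minimal resolution.  The same assembly applies verbatim to ANY ring
map `φ : ↥T →+* P` in place of an over-ring `P ≤ K`: if `ca(T) = ⋂_j I_{Z_j}` and every valuation set
maps to a principal ideal under `φ`, then so does `ca(T)`. -/

/-- **G4′ form, one cycle.**  If `ca(T) = I_Z` and `φ(I_Z) · P` is principal for a ring map
`φ : ↥T →+* P` (e.g. `toStalk π x`), then `φ(ca(↥T)) · P` is principal. [folklore] -/
theorem isPrincipal_map_cohomologyAnnihilator_of_cycle (T : Subalgebra k K) {P : Type*} [CommRing P]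
    (φ : ↥T →+* P) {ι : Type*} (v : ι → K → ℕ∞) (Z : ι → ℕ)
    (hca : ∀ a : K, a ∈ ca T ↔ a ∈ T ∧ ∀ i, (Z i : ℕ∞) ≤ v i a)
    (hLip : (Ideal.span (φ '' {x : ↥T | ∀ i, (Z i : ℕ∞) ≤ v i (x : K)})).IsPrincipal) :
    (Ideal.map φ (cohomologyAnnihilator ↥T)).IsPrincipal := by
  have hset : ((cohomologyAnnihilator ↥T : Ideal ↥T) : Set ↥T) =
      {x : ↥T | ∀ i, (Z i : ℕ∞) ≤ v i (x : K)} := by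
    ext x
    rw [SetLike.mem_coe, ← tn_coe_mem_ca_iff T x, hca]
    exact ⟨fun h => h.2, fun h => ⟨x.2, h⟩⟩
  rw [Ideal.map, hset]
  exact hLip

/-- **G4′ form at a singular stage, plain.**  As `skyPrincipal_of_cycleFamily`, concluding at a ring map
`φ : ↥T_m →+* P` (the stalk map of a minimal resolution at a closed-fibre point): `ca(T_m) = ⋂_j I_{Z_j}`
(CA4 + Lemma C + Lemma A) and «every valuation set becomes principal under `φ`» (Laufer + Lipman
(12.1)(ii)) give `(Ideal.map φ (ca ↥T_m)).IsPrincipal`. [folklore] -/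
theorem caMapPrincipal_of_cycleFamily (O : ValuationSubring K) (A R : Subalgebra k K) (m₀ : ℕ)
    (ctx : SandwichCtx O A R m₀) (m : ℕ) (hm : m₀ + 1 ≤ m)
    (hsing : ¬ IsRegularLocalRing ↥(tower O A m))
    {ι : Type*} (v : ι → K → ℕ∞) (hfin : ∀ i, ∀ a ∈ tower O A m, a ≠ 0 → v i a ≠ ⊤)
    {J : Sort*} (Z : J → ι → ℕ)
    (hca : ∀ a : K, a ∈ ca (tower O A m) ↔ a ∈ tower O A m ∧ ∀ j i, (Z j i : ℕ∞) ≤ v i a)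
    {P : Type*} [CommRing P] (φ : ↥(tower O A m) →+* P)
    (hLip : ∀ Z : ι → ℕ,
      (Ideal.span (φ '' {x : ↥(tower O A m) | ∀ i, (Z i : ℕ∞) ≤ v i (x : K)})).IsPrincipal) :
    (Ideal.map φ (cohomologyAnnihilator ↥(tower O A m))).IsPrincipal := by
  obtain ⟨hk, hA, hfr, hAO, htr, -⟩ := ctx
  obtain ⟨n, rfl⟩ : ∃ n, m = n + 1 := ⟨m - 1, by omega⟩
  obtain ⟨y, hyca, hy0, -⟩ := exists_admissible_of_not_isRegularLocalRing O A hk hA hfr hAO htr n hsing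
  obtain ⟨Zs, -, hZs⟩ := exists_cycle_of_cycleFamily (tower O A (n + 1)) v Z hca
    ⟨y, hyca, fun i => hfin i y (ca_subset _ hyca) hy0⟩
  exact isPrincipal_map_cohomologyAnnihilator_of_cycle (tower O A (n + 1)) φ v Zs hZs (hLip Zs)

/-- **G4′ form at a singular stage, Laufer–Lipman.**  As `caMapPrincipal_of_cycleFamily`, with the
principality hypothesis at ANTI-NEF cycles only. [folklore] -/
theorem caMapPrincipal_of_cycleFamily_of_antinef (O : ValuationSubring K) (A R : Subalgebra k K)
    (m₀ : ℕ) (ctx : SandwichCtx O A R m₀) (m : ℕ) (hm : m₀ + 1 ≤ m)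
    (hsing : ¬ IsRegularLocalRing ↥(tower O A m))
    {ι : Type*} [Fintype ι] (v : ι → K → ℕ∞) (hzero : ∀ i, v i 0 = ⊤)
    (hfin : ∀ i, ∀ a ∈ tower O A m, a ≠ 0 → v i a ≠ ⊤)
    (B : ι → ι → ℤ) (hB : ∀ i j, i ≠ j → 0 ≤ B i j)
    (hdiv : ∀ a ∈ tower O A m, a ≠ 0 → ∀ i, ∑ j, ((v j a).toNat : ℤ) * B j i ≤ 0)
    {J : Sort*} (Z : J → ι → ℕ)
    (hca : ∀ a : K, a ∈ ca (tower O A m) ↔ a ∈ tower O A m ∧ ∀ j i, (Z j i : ℕ∞) ≤ v i a)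
    {P : Type*} [CommRing P] (φ : ↥(tower O A m) →+* P)
    (hLip : ∀ Z : ι → ℕ, (∀ i, ∑ j, (Z j : ℤ) * B j i ≤ 0) →
      (Ideal.span (φ '' {x : ↥(tower O A m) | ∀ i, (Z i : ℕ∞) ≤ v i (x : K)})).IsPrincipal) :
    (Ideal.map φ (cohomologyAnnihilator ↥(tower O A m))).IsPrincipal := by
  obtain ⟨hk, hA, hfr, hAO, htr, -⟩ := ctx
  obtain ⟨n, rfl⟩ : ∃ n, m = n + 1 := ⟨m - 1, by omega⟩
  obtain ⟨y, hyca, hy0, -⟩ := exists_admissible_of_not_isRegularLocalRing O A hk hA hfr hAO htr n hsing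
  have hyT : y ∈ tower O A (n + 1) := ca_subset _ hyca
  obtain ⟨Zs, -, hZs⟩ := exists_cycle_of_cycleFamily (tower O A (n + 1)) v Z hca
    ⟨y, hyca, fun i => hfin i y hyT hy0⟩
  obtain ⟨Z', -, hanti, hZ'⟩ := exists_antinef_cycle_of_forall_sum_le (tower O A (n + 1)) v hzero hfin
    B hB hdiv Zs ⟨y, hyT, hy0, ((hZs y).mp hyca).2⟩
  exact isPrincipal_map_cohomologyAnnihilator_of_cycle (tower O A (n + 1)) φ v Z'
    (fun a => (hZs a).trans (hZ' a)) (hLip Z' hanti)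

end Summit.ResolutionOfSingularities.ResolutionOfSingularities.Theorems.NoZeno.SandwichCluster

end
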